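import Mathlib.Algebra.BigOperators.Fin
import Mathlib.Data.Int.CharZero
import Mathlib.Tactic.Ring
import Mathlib.Tactic.Linarith
import Mathlib.Tactic.Positivity
import HarnessLib

/-!
# Coefficient lists: a computable model of `ℤ[t]` for kernel-checked certificates

Topic `Literature/Algebra/Polynomial`; a trunk-independent tool.  Univariate integer polynomials
as little-endian coefficient lists `[a₀, a₁, …] ↦ a₀ + a₁ t + ⋯`, with exactly the operations a
`decide`-checked certificate needs and their semantics under evaluation in a commutative ring:

* `CoeffList.eval t p` and the arithmetic `add`, `smul`, `mul` (`eval_add`, `eval_smul`,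
  `eval_mul`); the tests `isZero` (`eval_eq_zero_of_isZero`), `allNonneg`, `allNonpos` and
  `sameSign` with the **positivity criterion** `eval_ne_zero_of_sameSign`: a list of coefficients
  of one sign, not all zero, does not vanish at `t = n` for any natural number `n ≥ 1` (in
  characteristic zero);
* sparse row combinations `sdot L f = ∑_{(r,c) ∈ L} c · f r` of rows given one column at a time,
  the coefficient vector `rowVec` of such a sparse row, and the bridge `eval_sdot_eq_sum` from the
  list computation to a `Finset` sum — i.e. to an entry of a matrix product `P * A` whose entries
  are values of coefficient lists (used with the rank criterion of
  `LinearAlgebra/Matrix/RowOperationCertificate.lean`).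

Everything is PROVED; nothing here decides equality of polynomials (only the sufficient syntactic
tests above are used), so no normal form is needed.

## Prior copies of this model in the tree (for a librarian `refactor:`)

The same list arithmetic exists, specialised and behind heavier import chains, in
* `Literature/NumberTheory/EllipticCurves/IsogenyFormulaCert.lean` (`PolyCert.addL`, `smulL`,
  `mulL`, `isZeroL`, interpreted into `R[X]` by `ofList`) — `add`/`mul` here use the identical
  recursion (this `smul` does not special-case `0`);
* `Literature/NumberTheory/EllipticCurves/IsogenyFormulaCertKronecker.lean` (`evalL` = `eval` at `ℤ`);
* `Literature/Algebra/Polynomial/KroneckerCertificate.lean` (`PExpr.horner` = `eval` at `ℤ`).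
This file is the light, dependency-free version intended to be shared; those copies can be
retargeted to it.
-/

namespace Literature.Algebra.Polynomial.CoeffList

variable {R : Type*} [CommRing R]

/-! ## Evaluation and arithmetic -/

/-- Evaluation of a little-endian coefficient list at `t`: `eval t [a₀, a₁, …] = a₀ + a₁ t + ⋯`.
[folklore] -/
def eval (t : R) : List ℤ → R
  | [] => 0
  | a :: p => (a : R) + t * eval t p

/-- `eval t [] = 0`. [folklore] -/
@[simp] theorem eval_nil (t : R) : eval t [] = 0 := rfl

/-- `eval t (a :: p) = a + t · eval t p`. [folklore] -/
@[simp] theorem eval_cons (t : R) (a : ℤ) (p : List ℤ) : eval t (a :: p) = a + t * eval t p := rfl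

/-- Sum of coefficient lists. [folklore] -/
def add : List ℤ → List ℤ → List ℤ
  | [], q => q
  | a :: p, [] => a :: p
  | a :: p, b :: q => (a + b) :: add p q

/-- Integer multiple of a coefficient list. [folklore] -/
def smul (a : ℤ) : List ℤ → List ℤ
  | [] => []
  | b :: q => (a * b) :: smul a q

/-- Product of coefficient lists (`(a + t p) q = a q + t (p q)`). [folklore] -/
def mul : List ℤ → List ℤ → List ℤ
  | [], _ => []
  | a :: p, q => add (smul a q) (0 :: mul p q)

/-- All coefficients vanish. [folklore] -/
def isZero : List ℤ → Bool
  | [] => true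
  | a :: p => (a == 0) && isZero p

/-- All coefficients are `≥ 0`. [folklore] -/
def allNonneg : List ℤ → Bool
  | [] => true
  | a :: p => decide (0 ≤ a) && allNonneg p

/-- All coefficients are `≤ 0`. [folklore] -/
def allNonpos : List ℤ → Bool
  | [] => true
  | a :: p => decide (a ≤ 0) && allNonpos p

/-- The coefficients have one sign and do not all vanish (so the value at any `t ≥ 1` is
non-zero). [folklore] -/
def sameSign (p : List ℤ) : Bool := (allNonneg p || allNonpos p) && !(isZero p)

/-- `eval` is additive. [folklore] -/
theorem eval_add (t : R) : ∀ p q : List ℤ, eval t (add p q) = eval t p + eval t q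
  | [], q => by simp [add]
  | a :: p, [] => by simp [add]
  | a :: p, b :: q => by
    simp only [add, eval_cons, eval_add t p q, Int.cast_add]
    ring

/-- `eval` commutes with integer multiples. [folklore] -/
theorem eval_smul (t : R) (a : ℤ) : ∀ q : List ℤ, eval t (smul a q) = a * eval t q
  | [] => by simp [smul]
  | b :: q => by
    simp only [smul, eval_cons, eval_smul t a q, Int.cast_mul]
    ring

/-- `eval` is multiplicative. [folklore] -/
theorem eval_mul (t : R) : ∀ p q : List ℤ, eval t (mul p q) = eval t p * eval t q
  | [], q => by simp [mul]
  | a :: p, q => by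
    rw [mul, eval_add, eval_smul, eval_cons, eval_cons, eval_mul t p q, Int.cast_zero]
    ring

/-- A list of zeros evaluates to `0`. [folklore] -/
theorem eval_eq_zero_of_isZero (t : R) : ∀ p : List ℤ, isZero p = true → eval t p = 0
  | [], _ => rfl
  | a :: p, h => by
    simp only [isZero, Bool.and_eq_true, beq_iff_eq] at h
    rw [eval_cons, h.1, eval_eq_zero_of_isZero t p h.2]
    simp

/-! ## The positivity criterion -/

/-- Evaluation at a natural number, computed in `ℤ`, casts to the evaluation in `R`. [folklore] -/
theorem eval_natCast (n : ℕ) : ∀ p : List ℤ, ((eval (n : ℤ) p : ℤ) : R) = eval (n : R) p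
  | [] => by simp
  | a :: p => by
    rw [eval_cons, eval_cons, Int.cast_add, Int.cast_mul, eval_natCast n p]
    simp

/-- Non-negative coefficients give a non-negative value at `n : ℕ`. [folklore] -/
theorem eval_nonneg_of_allNonneg (n : ℕ) : ∀ p : List ℤ, allNonneg p = true → 0 ≤ eval (n : ℤ) p
  | [], _ => le_rfl
  | a :: p, h => by
    simp only [allNonneg, Bool.and_eq_true, decide_eq_true_eq] at h
    rw [eval_cons, Int.cast_id]
    exact add_nonneg h.1 (mul_nonneg (Int.natCast_nonneg n) (eval_nonneg_of_allNonneg n p h.2))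

/-- Non-negative coefficients, not all zero, give a value `≥ 1` at every `n ≥ 1`. [folklore] -/
theorem one_le_eval_of_allNonneg {n : ℕ} (hn : 1 ≤ n) :
    ∀ p : List ℤ, allNonneg p = true → isZero p = false → 1 ≤ eval (n : ℤ) p
  | [], _, h => by simp [isZero] at h
  | a :: p, h, hz => by
    simp only [allNonneg, Bool.and_eq_true, decide_eq_true_eq] at h
    simp only [isZero, Bool.and_eq_false_iff, beq_eq_false_iff_ne, ne_eq] at hz
    rw [eval_cons, Int.cast_id]
    have hp := eval_nonneg_of_allNonneg n p h.2
    rcases hz with ha | hz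
    · have : 1 ≤ a := by omega
      nlinarith
    · have h1 := one_le_eval_of_allNonneg hn p h.2 (by simpa using hz)
      nlinarith

/-- `allNonpos p` is `allNonneg` of the negated list. [folklore] -/
theorem allNonneg_smul_neg_one : ∀ p : List ℤ, allNonpos p = true → allNonneg (smul (-1) p) = true
  | [], _ => rfl
  | a :: p, h => by
    simp only [allNonpos, Bool.and_eq_true, decide_eq_true_eq] at h
    simp only [smul, allNonneg, Bool.and_eq_true, decide_eq_true_eq]
    exact ⟨by omega, allNonneg_smul_neg_one p h.2⟩

/-- Negation preserves "not all zero". [folklore] -/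
theorem isZero_smul_neg_one : ∀ p : List ℤ, isZero p = false → isZero (smul (-1) p) = false
  | [], h => by simp [isZero] at h
  | a :: p, h => by
    simp only [isZero, Bool.and_eq_false_iff, beq_eq_false_iff_ne, ne_eq] at h
    simp only [smul, isZero, Bool.and_eq_false_iff, beq_eq_false_iff_ne, ne_eq]
    rcases h with h | h
    · left; omega
    · right; exact isZero_smul_neg_one p h

/-- **Positivity criterion.** A coefficient list of one sign, not all zero, does not vanish at
`t = n` for any natural number `n ≥ 1`, in any ring of characteristic zero. [folklore] -/
theorem eval_ne_zero_of_sameSign [CharZero R] {n : ℕ} (hn : 1 ≤ n) (p : List ℤ)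
    (h : sameSign p = true) : eval (n : R) p ≠ 0 := by
  rw [← eval_natCast, Int.cast_ne_zero]
  simp only [sameSign, Bool.and_eq_true, Bool.or_eq_true, Bool.not_eq_true'] at h
  obtain ⟨h1 | h1, h2⟩ := h
  · have := one_le_eval_of_allNonneg hn p h1 h2
    omega
  · have h3 := one_le_eval_of_allNonneg hn (smul (-1) p) (allNonneg_smul_neg_one p h1)
      (isZero_smul_neg_one p h2)
    rw [eval_smul] at h3
    intro h0
    rw [h0] at h3
    simp at h3

/-! ## Sparse row combinations -/

/-- The sparse row combination `∑_{(r, c) ∈ L} c · f r` of rows `f r` given entrywise (one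
column at a time: `f r` is the entry of row `r` in the column under consideration). [folklore] -/
def sdot (L : List (ℕ × List ℤ)) (f : ℕ → List ℤ) : List ℤ :=
  L.foldr (fun rc acc => add (mul rc.2 (f rc.1)) acc) []

/-- The coefficient vector on `Fin m` of a sparse row `L` (entries with equal index add up;
indices `≥ m` are dropped). [folklore] -/
def rowVec (t : R) (L : List (ℕ × List ℤ)) (m : ℕ) (r : Fin m) : R :=
  (L.map fun rc => if rc.1 = (r : ℕ) then eval t rc.2 else 0).sum

/-- `rowVec` of the empty row is `0`. [folklore] -/
@[simp] theorem rowVec_nil (t : R) (m : ℕ) (r : Fin m) : rowVec t [] m r = 0 := by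
  simp [rowVec]

/-- `rowVec` of a non-empty row. [folklore] -/
theorem rowVec_cons (t : R) (rc : ℕ × List ℤ) (L : List (ℕ × List ℤ)) (m : ℕ) (r : Fin m) :
    rowVec t (rc :: L) m r = (if rc.1 = (r : ℕ) then eval t rc.2 else 0) + rowVec t L m r := by
  simp [rowVec]

/-- **The bridge.** The value of the sparse combination is the `Finset` sum
`∑_r (rowVec L) r · (value of row r)`, i.e. an entry of the matrix product `P * A` where `P`
has rows `rowVec Lₐ` and `A r j = eval t (g r)`, provided all indices in `L` are `< m`. [folklore] -/
theorem eval_sdot_eq_sum (t : R) {m : ℕ} (f : ℕ → List ℤ) (g : Fin m → List ℤ)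
    (hfg : ∀ r : Fin m, f r = g r) :
    ∀ L : List (ℕ × List ℤ), (∀ rc ∈ L, rc.1 < m) →
      eval t (sdot L f) = ∑ r : Fin m, rowVec t L m r * eval t (g r)
  | [], _ => by simp [sdot]
  | rc :: L, hL => by
    have hrc : rc.1 < m := hL rc (by simp)
    have ih := eval_sdot_eq_sum t f g hfg L fun x hx => hL x (by simp [hx])
    rw [sdot, List.foldr_cons, ← sdot, eval_add, eval_mul, ih]
    simp only [rowVec_cons, add_mul, Finset.sum_add_distrib]
    congr 1
    rw [Finset.sum_eq_single (⟨rc.1, hrc⟩ : Fin m)]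
    · simp [hfg ⟨rc.1, hrc⟩]
    · intro r _ hr
      rw [if_neg, zero_mul]
      intro h
      exact hr (Fin.ext h.symm)
    · intro h; exact absurd (Finset.mem_univ _) h

end Literature.Algebra.Polynomial.CoeffList
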